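import Literature.NumberTheory.EllipticCurves.BSDQuadraticDescentCasselsHeightProofs
import Literature.NumberTheory.EllipticCurves.BSDShaProofs
import Literature.NumberTheory.EllipticCurves.TamagawaFiniteIndexProofs
import Literature.NumberTheory.EllipticCurves.IsogenyDualProofs
import Literature.NumberTheory.EllipticCurves.LeadingTerm
import HarnessLib

/-!
# Tamagawa parity along a rational `p`-isogeny with `p`-adic-unit period ratio
# (Dokchitser–Dokchitser 2015, Thm. 8.2 (1) ⇒ (2), from Cassels' isogeny invariance and the
# Cassels–Tate pairing)

Theorems only (no definition, no named fact). For `ℚ`-isogenous globally minimal elliptic curves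
`E`, `E'` over `ℚ`, a `ℚ`-isogeny `φ : E → E'` of PRIME degree `p` and real periods related by
`Ω(E') = u · Ω(E)` with `u ∈ ℚ` a `p`-ADIC UNIT, the `p`-adic valuations of the Tamagawa products
satisfy

  `ord_p ∏_ℓ c_ℓ(E) + ord_p ∏_ℓ c_ℓ(E') ≡ rank E(ℚ) (mod 2)`

(`WeierstrassCurve.Isogeny.even_padicValNat_tamagawaProduct_add_rank`), granted, as named facts
of the tree, Cassels' isogeny invariance of the Birch–Swinnerton-Dyer quotient
(`WeierstrassCurve.bsdRHS_eq_of_isIsogenous`, Cassels 1965 / Milne *ADT* I.7.3) and the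
Cassels–Tate pairing (`WeierstrassCurve.exists_casselsTate_pairing`, *AEC* X.4.14: `#Ш` is a
square when finite), and the finiteness of `Ш(E/ℚ)`. In particular, when the rank is ODD one of
`E`, `E'` has `p ∣ ∏_ℓ c_ℓ` (`dvd_tamagawaProduct_or_of_odd_rank`).

This is the direction (1) ⇒ (2) of T. Dokchitser–V. Dokchitser, *Local invariants of isogenous
elliptic curves*, Trans. AMS 367 (2015), **Thm. 8.2** (= arXiv:1208.5519 Thm. 32): "Let
`φ : E → E'` be a rational `p`-isogeny of elliptic curves over `ℚ`. Then the quotient `Ω/Ω'` is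
`p, 1` or `p⁻¹`, and the following are equivalent: (1) `Ω = Ω'`. (2)
`Σ_l ord_p(c(E/ℚ_l)/c(E'/ℚ_l)) ≡ ord_{s=1} L(E,s) (mod 2)`", whose printed proof uses the
`p`-parity theorem and Cassels' Selmer formula; here the algebraic rank replaces the analytic one
(equal under Gross–Zagier–Kolyvagin in analytic rank `≤ 1`) and the proof is Milne's bookkeeping:
by Cassels, `#Ш·Reg·Ω·∏c_ℓ/#tors²` agrees on `E` and `E'`; the regulators satisfy
`[E'/t : φ(E/t)]·Reg(E') = Reg(E)·[E/t : φ̂(E'/t)]` (tree theorem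
`index_mul_regulator_eq_regulator_mul_index`, adjointness of `φ, φ̂` for the Néron–Tate pairings
`Isogeny.heightPairing_pointHom_left`) with `[E'/t : φ(E/t)]·[E/t : φ̂(E'/t)] = p^{rank}`
(`φ̂ ∘ φ = [p]` on the free quotient of rank `rank E(ℚ)`; §1), both `#Ш` are squares, and the
period ratio is a `p`-adic unit — so `ord_p` of the remaining NATURAL numbers gives the congruence.

The hypothesis "`Ω(E') = u·Ω(E)`, `|u|_p = 1`" is exactly the output of the tree's KERNEL theorem
`Summit.BirchSwinnertonDyer.Rank1Residual.X2.IsogenyPeriodRatio.exists_quot_realPeriodRat_eq_unit_mul`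
(Greenberg–Vatsal Cor. (3.8), period clause: the quotient of `E` by an unramified odd rational
`p`-line at a good ordinary or multiplicative odd `p`), which is how the cell
`bsd-schneider-ideate` (seat `bsd-schneider-i1-c2`, gen 8) uses it on corner A2.

* §1 `Literature.NumberTheory.EllipticCurves.index_range_mul_index_range_eq_pow` — for injective
  `u : Λ → Λ'`, `v : Λ' → Λ` between lattices with `v ∘ u = [m]` and `Λ` free of rank `r`:
  `[Λ' : u(Λ)] · [Λ : v(Λ')] = m ^ r`.
* §2 `WeierstrassCurve.Isogeny.index_mul_index_eq_pow_rank` — the instance for the free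
  Mordell–Weil quotients along `φ` and its dual.
* §3 `WeierstrassCurve.Isogeny.even_padicValNat_tamagawaProduct_add_rank`,
  `WeierstrassCurve.Isogeny.dvd_tamagawaProduct_or_of_odd_rank`.

References: [DokchitserDokchitser2015LocalInvariants] Thm. 8.2 (TAMS p. 4352; arXiv Thm. 32);
[Cassels1965ArithmeticVIII]; [MilneADT2006] Thm. I.7.3 and its proof, pp. 97–100;
[SilvermanAEC2009] Thm. X.4.14.
-/

noncomputable section

open scoped Classical

universe u

/-! ## §1. Index calculus: `[Λ' : u(Λ)] · [Λ : v(Λ')] = m ^ rank` when `v ∘ u = [m]` -/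

namespace Literature.NumberTheory.EllipticCurves

open Module

/-- **Index product along a pair of mutually quasi-inverse lattice maps.** For abelian groups
`Λ, Λ'` with `Λ` free of finite rank (basis `b` indexed by `ι`), injective homomorphisms
`u : Λ → Λ'`, `v : Λ' → Λ` with `v (u x) = m • x`, one has
`[Λ' : u(Λ)] · [Λ : v(Λ')] = m ^ #ι`: indeed `[Λ : v(u(Λ))] = [Λ : v(Λ')]·[Λ' : u(Λ)]` (`v`
injective) and `[Λ : mΛ] = |det(m · 1)| = m ^ #ι`. The Mordell–Weil instance (`v ∘ u = [deg φ]`)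
is the index bookkeeping behind `z(f(K))/z(f^t(K))` in Milne, *ADT*, proof of Thm. I.7.3 (p. 97).
[cite: MilneADT2006, Ch. I, proof of Thm. 7.3, p. 97] -/
theorem index_range_mul_index_range_eq_pow {Λ Λ' : Type*} [AddCommGroup Λ] [AddCommGroup Λ']
    {ι : Type*} [Fintype ι] [DecidableEq ι] (b : Basis ι ℤ Λ) (u : Λ →+ Λ') (v : Λ' →+ Λ)
    (hu : Function.Injective u) (hv : Function.Injective v) (m : ℕ)
    (hvu : ∀ x, v (u x) = m • x) :
    u.range.index * v.range.index = m ^ Fintype.card ι := by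
  have hvu_inj : Function.Injective (v.comp u) := fun x y hxy ↦ hu (hv hxy)
  -- `[Λ : v(u(Λ))] = [Λ' : u(Λ)] · [Λ : v(Λ')]`
  have h1 : (v.comp u).range.index = u.range.index * v.range.index := by
    rw [← AddMonoidHom.map_range]
    exact AddSubgroup.index_map_of_injective (H := u.range) hv
  -- `[Λ : v(u(Λ))] = |det(b; (v ∘ u) ∘ b)| = |det (m • 1)| = m ^ #ι`
  have h2 : (v.comp u).range.index = (b.det ((v.comp u) ∘ b)).natAbs :=
    index_range_eq_natAbs_det _ hvu_inj b b
  have h3 : b.det ((v.comp u) ∘ b) = (m : ℤ) ^ Fintype.card ι := by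
    have hfun : (v.comp u) ∘ b = fun i ↦ (m : ℤ) • b i := by
      ext i
      simp [hvu, natCast_zsmul]
    have hM : b.toMatrix (fun i ↦ (m : ℤ) • b i) = (m : ℤ) • (1 : Matrix ι ι ℤ) := by
      ext i j
      simp [Basis.toMatrix_apply, Matrix.one_apply, Finsupp.single_apply, eq_comm]
    rw [hfun, Basis.det_apply, hM, Matrix.det_smul, Matrix.det_one, mul_one]
  rw [← h1, h2, h3, Int.natAbs_pow, Int.natAbs_natCast]

end Literature.NumberTheory.EllipticCurves

/-! ## §2. The Mordell–Weil indices along an isogeny and its dual -/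

namespace WeierstrassCurve

namespace Isogeny

open Module Literature.NumberTheory.EllipticCurves Affine.Point

variable {K : Type u} [Field K] [NumberField K] {W W' : WeierstrassCurve K} [W.IsElliptic]

/-- **`[E'(K)/t : φ(E(K)/t)] · [E(K)/t : φ̂(E'(K)/t)] = (deg φ)^{rank E(K)}`** for a `K`-isogeny
`φ : E → E'` of elliptic curves over a number field, `φ̂` with `φ̂ ∘ φ = [deg φ]`, `f = φ(K)`,
`g = φ̂(K)` the maps on rational points and `f̄, ḡ` the induced (injective) maps on the free
quotients `E(K)/tors`, `E'(K)/tors` (Mordell–Weil: `E(K)/tors` is free of rank `rank E(K)`,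
`exists_isMordellWeilBasis_holds`). Milne, *ADT*, proof of Thm. I.7.3 (p. 97), the indices
`(A(K) : Σℤaᵢ)`, `(B(K) : Σℤbᵢ)`. [cite: MilneADT2006, Ch. I, proof of Thm. 7.3, p. 97] -/
theorem index_mul_index_eq_pow_rank (φ : Isogeny W W') (ψ : Isogeny W' W)
    (hψφ : ∀ P : W.geomPoints, ψ (φ P) = (φ.degree : ℤ) • P)
    {f : W.toAffine.Point →+ W'.toAffine.Point}
    (hf : ∀ P, W'.toGeomPoints (f P) = φ (W.toGeomPoints P))
    {g : W'.toAffine.Point →+ W.toAffine.Point}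
    (hg : ∀ Q, W.toGeomPoints (g Q) = ψ (W'.toGeomPoints Q))
    (hfT : (AddCommGroup.torsion W'.toAffine.Point).comap f =
      AddCommGroup.torsion W.toAffine.Point)
    (hgT : (AddCommGroup.torsion W.toAffine.Point).comap g =
      AddCommGroup.torsion W'.toAffine.Point) :
    (QuotientAddGroup.map _ _ f hfT.ge).range.index *
        (QuotientAddGroup.map _ _ g hgT.ge).range.index = φ.degree ^ W.mordellWeilRank := by
  have hgf : ∀ P, g (f P) = φ.degree • P := pointHom_comp_eq_nsmul φ ψ hψφ hf hg
  set fb := QuotientAddGroup.map _ _ f hfT.ge with hfb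
  set gb := QuotientAddGroup.map _ _ g hgT.ge with hgb
  have hfinj : Function.Injective fb := by
    rw [← AddMonoidHom.ker_eq_bot_iff, hfb, QuotientAddGroup.ker_map, hfT,
      AddSubgroup.map_eq_bot_iff, QuotientAddGroup.ker_mk']
  have hginj : Function.Injective gb := by
    rw [← AddMonoidHom.ker_eq_bot_iff, hgb, QuotientAddGroup.ker_map, hgT,
      AddSubgroup.map_eq_bot_iff, QuotientAddGroup.ker_mk']
  have hgbfb : ∀ x, gb (fb x) = φ.degree • x := by
    intro x
    induction x using QuotientAddGroup.induction_on with
    | H P => rw [hfb, hgb, QuotientAddGroup.map_mk, QuotientAddGroup.map_mk, hgf,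
        QuotientAddGroup.mk_nsmul]
  obtain ⟨P, hP⟩ := exists_isMordellWeilBasis_holds W
  let b : Basis (Fin W.mordellWeilRank) ℤ (mordellWeilModTorsion W) := Basis.mk hP.1 hP.2.ge
  have key := index_range_mul_index_range_eq_pow b fb gb hfinj hginj φ.degree hgbfb
  rwa [Fintype.card_fin] at key

end Isogeny

/-! ## §3. Tamagawa parity from Cassels' theorem and the Cassels–Tate pairing -/

namespace Isogeny

open Literature.NumberTheory.EllipticCurves Affine.Point

variable {W W' : WeierstrassCurve ℚ} [W.IsElliptic] [W'.IsElliptic] [W.IsGloballyMinimal]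
  [W'.IsGloballyMinimal] {p : ℕ} [hp : Fact p.Prime]

/-- **Tamagawa parity along a rational `p`-isogeny with `p`-adic-unit period ratio**
(Dokchitser–Dokchitser 2015, Thm. 8.2 (1) ⇒ (2), algebraic-rank form, DERIVED from Cassels'
theorem and the Cassels–Tate pairing). Let `W ∼ W'` be globally minimal elliptic curves over `ℚ`,
`φ : W → W'` a `ℚ`-isogeny of prime degree `p`, `Ш(W/ℚ)` finite, and suppose the real periods
satisfy `Ω(W') = u · Ω(W)` with `u ∈ ℚ`, `|u|_p = 1`. Then
`ord_p ∏c_ℓ(W) + ord_p ∏c_ℓ(W') + rank W(ℚ)` is EVEN. Inputs by name: Cassels' isogeny invariance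
of `#Ш·Reg·Ω·∏c_ℓ/#tors²` (`hCas`), the Cassels–Tate pairing (`hCT`: `#Ш` square); the regulator
term and `[E'/t : φ(E/t)]·[E/t : φ̂(E'/t)] = p^{rank}` are tree theorems.
[cite: DokchitserDokchitser2015LocalInvariants, Thm. 8.2 (= arXiv:1208.5519 Thm. 32)]
[cite: MilneADT2006, Ch. I, Thm. 7.3 and its proof, pp. 97–100]
[cite: SilvermanAEC2009, Thm. X.4.14] -/
theorem even_padicValNat_tamagawaProduct_add_rank
    (hCas : bsdRHS_eq_of_isIsogenous) (hCT : exists_casselsTate_pairing (K := ℚ))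
    (φ : Isogeny W W') (hdeg : φ.degree = p) (hfin : W.ShaFinite)
    {u : ℚ} (hu : ‖(u : ℚ_[p])‖ = 1) (hΩ : W'.realPeriodRat = (u : ℝ) * W.realPeriodRat) :
    Even (padicValNat p W.tamagawaProduct + padicValNat p W'.tamagawaProduct +
      W.mordellWeilRank) := by
  -- the group law on `E(ℚ)` with the classical `DecidableEq ℚ` of the general-field theorems
  letI : DecidableEq ℚ := fun a b ↦ Classical.propDecidable (a = b)
  have hpP : p.Prime := hp.out
  -- the dual isogeny and the maps on rational points
  obtain ⟨ψ, hψφ⟩ := φ.exists_dual_of_isElliptic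
  obtain ⟨f, hf⟩ := φ.exists_pointHom
  obtain ⟨g, hg⟩ := ψ.exists_pointHom
  have hgf : ∀ P, g (f P) = φ.degree • P := pointHom_comp_eq_nsmul φ ψ hψφ hf hg
  have hfg : ∀ Q, f (g Q) = φ.degree • Q :=
    pointHom_comp_eq_nsmul ψ φ (comp_eq_zsmul_of_comp_eq_zsmul φ ψ hψφ) hg hf
  have hm : φ.degree ≠ 0 := φ.degree_pos.ne'
  have hfT := comap_torsion_eq_of_comp_eq_nsmul f g hm hgf
  have hgT := comap_torsion_eq_of_comp_eq_nsmul g f hm hfg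
  -- regulators: `i · Reg' = Reg · j`, and `i · j = p ^ rank`
  have hadj := heightPairing_pointHom_left φ ψ hψφ hf hg
  have hC := index_mul_regulator_eq_regulator_mul_index f g hfT hgT hadj
  have hij := index_mul_index_eq_pow_rank φ ψ hψφ hf hg hfT hgT
  rw [hdeg] at hij
  set i := (QuotientAddGroup.map _ _ f hfT.ge).range.index with hi
  set j := (QuotientAddGroup.map _ _ g hgT.ge).range.index with hj
  have hi0 : i ≠ 0 := fun h ↦ by
    rw [h, zero_mul] at hij; exact (pow_ne_zero _ hpP.ne_zero) hij.symm
  have hj0 : j ≠ 0 := fun h ↦ by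
    rw [h, mul_zero] at hij; exact (pow_ne_zero _ hpP.ne_zero) hij.symm
  -- Cassels: equal BSD quotients; Cassels–Tate: `#Ш` squares
  obtain ⟨hfin', hRHS⟩ := hCas W W' ⟨φ⟩ hfin
  obtain ⟨s, hs⟩ := isSquare_shaOrder_of_casselsTate hCT W hfin
  obtain ⟨s', hs'⟩ := isSquare_shaOrder_of_casselsTate hCT W' hfin'
  -- positivity of the invariants
  have hSha : 0 < W.shaOrder := shaOrder_pos W hfin
  have hSha' : 0 < W'.shaOrder := shaOrder_pos W' hfin'
  have hT : 0 < W.torsionOrder := torsionOrder_pos_holds W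
  have hT' : 0 < W'.torsionOrder := torsionOrder_pos_holds W'
  have hc : 0 < W.tamagawaProduct := tamagawaProduct_pos_holds W
  have hc' : 0 < W'.tamagawaProduct := tamagawaProduct_pos_holds W'
  have hR : 0 < W.regulator := regulator_pos' W
  have hΩpos : 0 < W.realPeriodRat := by
    rw [realPeriodRat_def]; exact realPeriod_pos' _
  have hu0 : u ≠ 0 := by
    rintro rfl
    simp at hu
  -- the identity of rational numbers `#Ш'·j·c'·t²·u = i·#Ш·c·t'²`
  have E1 : (W'.shaOrder : ℝ) * W'.regulator * W'.realPeriodRat * W'.tamagawaProduct *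
      (W.torsionOrder : ℝ) ^ 2 =
      (W.shaOrder : ℝ) * W.regulator * W.realPeriodRat * W.tamagawaProduct *
      (W'.torsionOrder : ℝ) ^ 2 := by
    have h := hRHS
    rw [bsdRHS_def, bsdRHS_def, div_eq_div_iff (pow_ne_zero _ (by exact_mod_cast hT'.ne'))
      (pow_ne_zero _ (by exact_mod_cast hT.ne'))] at h
    linarith [h]
  have E2 : W.regulator * W.realPeriodRat *
      ((W'.shaOrder : ℝ) * j * W'.tamagawaProduct * (W.torsionOrder : ℝ) ^ 2 * u -
        (i : ℝ) * W.shaOrder * W.tamagawaProduct * (W'.torsionOrder : ℝ) ^ 2) = 0 := by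
    rw [hΩ] at E1
    linear_combination (i : ℝ) * E1 -
      ((W'.shaOrder : ℝ) * (u : ℝ) * W.realPeriodRat * W'.tamagawaProduct *
        (W.torsionOrder : ℝ) ^ 2) * hC
  have E3 : (W'.shaOrder : ℝ) * j * W'.tamagawaProduct * (W.torsionOrder : ℝ) ^ 2 * u =
      (i : ℝ) * W.shaOrder * W.tamagawaProduct * (W'.torsionOrder : ℝ) ^ 2 := by
    have hRΩ : W.regulator * W.realPeriodRat ≠ 0 := mul_ne_zero hR.ne' hΩpos.ne'
    have := (mul_eq_zero.mp E2).resolve_left hRΩ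
    linarith
  have E4 : ((W'.shaOrder * j * W'.tamagawaProduct * W.torsionOrder ^ 2 : ℕ) : ℚ) * u =
      ((i * W.shaOrder * W.tamagawaProduct * W'.torsionOrder ^ 2 : ℕ) : ℚ) := by
    have h : (((W'.shaOrder * j * W'.tamagawaProduct * W.torsionOrder ^ 2 : ℕ) : ℚ) * u : ℚ) =
        (((i * W.shaOrder * W.tamagawaProduct * W'.torsionOrder ^ 2 : ℕ) : ℚ) : ℝ) := by
      push_cast
      exact E3
    exact_mod_cast h
  -- `p`-adic valuations
  have hvu : padicValRat p u = 0 := by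
    have h := hu
    rw [Padic.norm_eq_zpow_neg_valuation (by exact_mod_cast hu0)] at h
    have h1 : (u : ℚ_[p]).valuation = 0 := by
      have hp1 : (1 : ℝ) < p := by exact_mod_cast hpP.one_lt
      have := zpow_right_injective₀ (by positivity) hp1.ne' (h.trans (zpow_zero _).symm)
      omega
    rwa [Padic.valuation_ratCast] at h1
  have hL : padicValRat p (((W'.shaOrder * j * W'.tamagawaProduct * W.torsionOrder ^ 2 : ℕ) : ℚ)
      * u) = (padicValNat p (W'.shaOrder * j * W'.tamagawaProduct * W.torsionOrder ^ 2) : ℤ) := by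
    rw [padicValRat.mul (by positivity) hu0, hvu, add_zero, padicValRat.of_nat]
  rw [E4, padicValRat.of_nat, Nat.cast_inj] at hL
  -- expand both sides
  have hsq : s ≠ 0 := fun h ↦ by rw [h, mul_zero] at hs; omega
  have hsq' : s' ≠ 0 := fun h ↦ by rw [h, mul_zero] at hs'; omega
  rw [padicValNat.mul (by positivity) (by positivity), padicValNat.mul (by positivity) (by positivity),
    padicValNat.mul (by positivity) (by positivity), padicValNat.pow _ 2,
    padicValNat.mul (by positivity) (by positivity), padicValNat.mul (by positivity) (by positivity),
    padicValNat.mul (by positivity) (by positivity), padicValNat.pow _ 2, hs, hs',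
    padicValNat.mul hsq hsq, padicValNat.mul hsq' hsq'] at hL
  have hvij : padicValNat p i + padicValNat p j = W.mordellWeilRank := by
    rw [← padicValNat.mul hi0 hj0, hij, padicValNat.prime_pow]
  rw [even_iff_two_dvd]
  omega

/-- **One of two `p`-isogenous curves of ODD rank has `p ∣ ∏c_ℓ`** (same hypotheses): if
`rank W(ℚ)` is odd then `ord_p ∏c_ℓ(W) + ord_p ∏c_ℓ(W')` is odd, so `p` divides one of the two
Tamagawa products. [cite: DokchitserDokchitser2015LocalInvariants, Thm. 8.2 (= arXiv:1208.5519 Thm. 32)]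
[cite: MilneADT2006, Ch. I, Thm. 7.3] -/
theorem dvd_tamagawaProduct_or_of_odd_rank
    (hCas : bsdRHS_eq_of_isIsogenous) (hCT : exists_casselsTate_pairing (K := ℚ))
    (φ : Isogeny W W') (hdeg : φ.degree = p) (hfin : W.ShaFinite)
    {u : ℚ} (hu : ‖(u : ℚ_[p])‖ = 1) (hΩ : W'.realPeriodRat = (u : ℝ) * W.realPeriodRat)
    (hodd : Odd W.mordellWeilRank) :
    p ∣ W.tamagawaProduct ∨ p ∣ W'.tamagawaProduct := by
  have h := even_padicValNat_tamagawaProduct_add_rank hCas hCT φ hdeg hfin hu hΩ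
  by_contra hnot
  push Not at hnot
  have h1 : padicValNat p W.tamagawaProduct = 0 := padicValNat.eq_zero_of_not_dvd hnot.1
  have h2 : padicValNat p W'.tamagawaProduct = 0 := padicValNat.eq_zero_of_not_dvd hnot.2
  rw [h1, h2, zero_add, zero_add] at h
  exact (Nat.not_even_iff_odd.mpr hodd) h


/-- **Dokchitser–Dokchitser 2015, Thm. 8.2 (1) ⇒ (2), in its printed (analytic-rank) currency for
`ord_{s=1} L(E,s) ≤ 1`**: for `ℚ`-isogenous globally minimal `W ∼ W'` via `φ` of prime degree `p`
with `Ω(W') = u · Ω(W)`, `|u|_p = 1`, and `r_an(W) ≤ 1`,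
`ord_p ∏c_ℓ(W) + ord_p ∏c_ℓ(W') ≡ ord_{s=1} L(W,s) (mod 2)` — the algebraic-rank theorem
`even_padicValNat_tamagawaProduct_add_rank` with `rank = r_an` and `Ш(W)` finite supplied by
Gross–Zagier–Kolyvagin (`hGZK`, Darmon 2004 Thm. 3.22). (The printed equivalence holds for every
rank, by the `p`-parity theorem; only the rank-`≤ 1` case is unconditional on BSD-type input here.)
[cite: DokchitserDokchitser2015LocalInvariants, Thm. 8.2 (= arXiv:1208.5519 Thm. 32)]
[cite: Darmon2004, Thm. 3.22 (= Thm. 1.14)] -/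
theorem even_padicValNat_tamagawaProduct_add_analyticRank
    (hCas : bsdRHS_eq_of_isIsogenous) (hCT : exists_casselsTate_pairing (K := ℚ))
    (hGZK : rank_eq_analyticRank_of_analyticRank_le_one)
    (φ : Isogeny W W') (hdeg : φ.degree = p) (hr : W.analyticRank ≤ 1)
    {u : ℚ} (hu : ‖(u : ℚ_[p])‖ = 1) (hΩ : W'.realPeriodRat = (u : ℝ) * W.realPeriodRat) :
    Even (padicValNat p W.tamagawaProduct + padicValNat p W'.tamagawaProduct +
      W.analyticRank) := by
  obtain ⟨hrank, hfin⟩ := hGZK W hr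
  have h := even_padicValNat_tamagawaProduct_add_rank hCas hCT φ hdeg hfin hu hΩ
  rwa [hrank] at h

/-- **Analytic rank one: one of two `p`-isogenous curves with `p`-adic-unit period ratio has
`p ∣ ∏c_ℓ`** (Thm. 8.2 (1) ⇒ (2) at `ord_{s=1} L(E,s) = 1`, with Gross–Zagier–Kolyvagin).
[cite: DokchitserDokchitser2015LocalInvariants, Thm. 8.2 (= arXiv:1208.5519 Thm. 32)]
[cite: Darmon2004, Thm. 3.22 (= Thm. 1.14)] -/
theorem dvd_tamagawaProduct_or_of_analyticRank_eq_one
    (hCas : bsdRHS_eq_of_isIsogenous) (hCT : exists_casselsTate_pairing (K := ℚ))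
    (hGZK : rank_eq_analyticRank_of_analyticRank_le_one)
    (φ : Isogeny W W') (hdeg : φ.degree = p) (hr : W.analyticRank = 1)
    {u : ℚ} (hu : ‖(u : ℚ_[p])‖ = 1) (hΩ : W'.realPeriodRat = (u : ℝ) * W.realPeriodRat) :
    p ∣ W.tamagawaProduct ∨ p ∣ W'.tamagawaProduct := by
  obtain ⟨hrank, hfin⟩ := hGZK W hr.le
  exact dvd_tamagawaProduct_or_of_odd_rank hCas hCT φ hdeg hfin hu hΩ (by rw [hrank, hr]; exact odd_one)

end Isogeny

end WeierstrassCurve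

end
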